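import Summits.ResolutionOfSingularities.ResolutionOfSingularities.Theorems.LossEntryW08
import HarnessLib

/-!
# LossEntryW09 — walk plumbing of the loss→entry law `LawLossEntry`, part 9/11

decomp-res-lens-3, gen 29 (HOME/decomp-res-lens-3/g29/NODE-g29.md).  TOOL at 0 toward the residual item
stmt-ResolutionOfSingularities-27367 (`WallCut.NoLossyStrictTailsDeep` ⟸ `LossEpisode.LawLossEntry`).  Imports part 8 (`Theorems.LossEntryW08`, to be landed first).

Contents: §14 binary forms (`linear_pow_eq_sum₂`, `coeff_single_linear_pow₂`, `coeff_linear_pow₂_eq_zero`) and `coeff_shears_a2_apex` (the apex coefficient that forces `λμ′ = 1`).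
-/

open MvPolynomial Finset
open Literature.AlgebraicGeometry.Resolution
open Literature.AlgebraicGeometry.Resolution.Hauser2010
open Literature.AlgebraicGeometry.Resolution.PointBlowup
open Summit.ResolutionOfSingularities.ResolutionOfSingularities.Theorems.TightDefectClasses
open Summit.ResolutionOfSingularities.ResolutionOfSingularities.Theorems.TightDefectStrongWalks
open Summit.ResolutionOfSingularities.ResolutionOfSingularities.Theorems.ItineraryCutClasses
open Summit.ResolutionOfSingularities.ResolutionOfSingularities.Theorems.BoundaryLedger
open Summit.ResolutionOfSingularities.ResolutionOfSingularities.Theorems.ProximityCut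
open Summit.ResolutionOfSingularities.ResolutionOfSingularities.Theorems.LossIsFatalLayer (chartMap chartMap_X chartMap_X_self
  chartMap_X_ne chartMap_C)
open Summit.ResolutionOfSingularities.ResolutionOfSingularities.Theorems.LossExitCone
open Summit.ResolutionOfSingularities.ResolutionOfSingularities.Theorems.LossPolygon

/-! ## §14 The (a)-presentation continued in the chart `l`: the apex coefficient that forces `λ μ' = 1` -/

namespace Summit.ResolutionOfSingularities.ResolutionOfSingularities.Theorems.LossPolygon

variable {K : Type} [Field K] [DecidableEq K]
variable {q : ℕ}

omit [DecidableEq K] in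
/-- Binomial expansion of a general binary linear form power `(δ u_k + γ u_i)^n`. [folklore] -/
theorem linear_pow_eq_sum₂ {i k : Fin 3} (γ δ : K) (n : ℕ) :
    (C δ * X k + C γ * X i : MvPolynomial (Fin 3) K) ^ n =
      ∑ a ∈ Finset.range (n + 1), monomial (ConeCut.binExp i k n a) (((n.choose a : ℕ) : K) * γ ^ (n - a) * δ ^ a) := by
  rw [add_pow]
  refine Finset.sum_congr rfl fun a _ => ?_
  rw [mul_pow, mul_pow, ← map_pow, ← map_pow, X_pow_eq_monomial, X_pow_eq_monomial, C_mul_monomial, C_mul_monomial,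
    monomial_mul, ← map_natCast C, mul_comm, C_mul_monomial]
  unfold ConeCut.binExp
  congr 1
  · rw [add_comm]
  · ring

omit [DecidableEq K] in
/-- The coefficient of `u_k^n` in `(δ u_k + γ u_i)^n` is `δ^n`. [folklore] -/
theorem coeff_single_linear_pow₂ {i k : Fin 3} (hki : k ≠ i) (γ δ : K) (n : ℕ) :
    coeff (Finsupp.single k n) ((C δ * X k + C γ * X i : MvPolynomial (Fin 3) K) ^ n) = δ ^ n := by
  classical
  rw [linear_pow_eq_sum₂, coeff_sum, Finset.sum_eq_single n]
  · rw [coeff_monomial, if_pos, Nat.choose_self, Nat.cast_one, one_mul, Nat.sub_self, pow_zero, one_mul]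
    unfold ConeCut.binExp
    rw [Nat.sub_self, Finsupp.single_zero, zero_add]
  · intro a ha hne
    rw [coeff_monomial, if_neg]
    intro h
    have h1 := congrArg (fun D : Fin 3 →₀ ℕ => D i) h
    unfold ConeCut.binExp at h1
    simp only [Finsupp.add_apply, Finsupp.single_eq_same, Finsupp.single_apply, if_neg hki] at h1
    have ha' : a ≤ n := Nat.lt_succ_iff.mp (Finset.mem_range.mp ha)
    omega
  · intro h; exact absurd (Finset.mem_range.mpr (Nat.lt_succ_self _)) h

omit [DecidableEq K] in
/-- `(δ u_k + γ u_i)^n` has no monomial involving the third letter. [folklore] -/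
theorem coeff_linear_pow₂_eq_zero {i k w : Fin 3} (hwi : w ≠ i) (hwk : w ≠ k) (γ δ : K) {n : ℕ} {E : Fin 3 →₀ ℕ}
    (hE : E w ≠ 0) : coeff E ((C δ * X k + C γ * X i : MvPolynomial (Fin 3) K) ^ n) = 0 := by
  classical
  rw [linear_pow_eq_sum₂, coeff_sum]
  refine Finset.sum_eq_zero fun a _ => ?_
  rw [coeff_monomial, if_neg]
  intro h
  apply hE
  rw [← h, ConeCut.binExp_apply_of_ne hwi hwk]

section PencilA2

variable {i j l : Fin 3}

omit [DecidableEq K] in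
/-- **APEX OF THE (a)-PRESENTATION IN THE OTHER CHART (PROVED):** the coefficient of `u_i^{r_i + r_j} u_l^s` in
`σ_{j,l,μ'} σ_{j,i,β} σ_{l,i,λβ} F` is `φ₀ β^{r_j} (1 − λ μ')^s`; its vanishing FORCES `λ μ' = 1` at a repeat in the chart `l`
after an (a)-loss. [new] -/
theorem coeff_shears_a2_apex (hij : i ≠ j) (hil : i ≠ l) (hjl : j ≠ l) {s o : ℕ} {r : Fin 3 →₀ ℕ} (hrl : r l = 0)
    (hro : r.degree + s = o) (φ₀ lam β μ' : K) {F : MvPolynomial (Fin 3) K} (hwall : ∀ D ∈ F.support, r ≤ D)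
    (hpen : ∀ E : Fin 3 →₀ ℕ, E.degree = s → coeff (r + E) F = φ₀ * coeff E ((X l - C lam * X j) ^ s)) :
    coeff (Finsupp.single i (r i + r j) + Finsupp.single l s) (shear j l μ' (shear j i β (shear l i (lam * β) F))) =
      φ₀ * β ^ (r j) * (1 - lam * μ') ^ s := by
  classical
  set P : MvPolynomial (Fin 3) K := monomial r φ₀ * (X l - C lam * X j) ^ s with hP
  have hFP : ∀ D : Fin 3 →₀ ℕ, D.degree = o → coeff D F = coeff D P := by
    intro D hD
    rw [hP, coeff_monomial_mul']
    by_cases hrD : r ≤ D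
    · rw [if_pos hrD]
      have hE : (D - r).degree = s := by
        have h1 : r + (D - r) = D := add_tsub_cancel_of_le hrD
        have h2 := congrArg Finsupp.degree h1
        rw [map_add, hD] at h2
        omega
      rw [← hpen (D - r) hE, add_tsub_cancel_of_le hrD]
    · rw [if_neg hrD]
      by_contra hne
      exact hrD (hwall D (mem_support_iff.mpr hne))
  have h1 : ∀ D : Fin 3 →₀ ℕ, D.degree = o → coeff D (shear l i (lam * β) F) = coeff D (shear l i (lam * β) P) :=
    fun D hD => coeff_shear_congr_degree l i (lam * β) hFP hD
  have h2 : ∀ D : Fin 3 →₀ ℕ, D.degree = o →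
      coeff D (shear j i β (shear l i (lam * β) F)) = coeff D (shear j i β (shear l i (lam * β) P)) :=
    fun D hD => coeff_shear_congr_degree j i β h1 hD
  set B : Fin 3 →₀ ℕ := Finsupp.single i (r i + r j) + Finsupp.single l s with hB
  have hBdeg : B.degree = o := by
    rw [hB, map_add, Finsupp.degree_single, Finsupp.degree_single, ← hro, degree_fin3 hij hil hjl r, hrl, add_zero]
  have hBi : B i = r i + r j := by
    rw [hB, Finsupp.add_apply, Finsupp.single_eq_same, Finsupp.single_apply, if_neg (Ne.symm hil), add_zero]
  have hBj : B j = 0 := by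
    rw [hB, Finsupp.add_apply, Finsupp.single_apply, if_neg hij, Finsupp.single_apply, if_neg (Ne.symm hjl), add_zero]
  have hBl : B l = s := by
    rw [hB, Finsupp.add_apply, Finsupp.single_apply, if_neg hil, Finsupp.single_eq_same, zero_add]
  rw [coeff_shear_congr_degree j l μ' h2 hBdeg]
  -- the two inner shears of `P`
  have e1 : shear l i (lam * β) (monomial r φ₀) = monomial r φ₀ := by
    rw [shear_monomial hij hil hjl (lam * β) r φ₀, hrl, zero_add, Finset.sum_range_one, shearExp_zero hij hil hjl, pow_zero,
      mul_one, Nat.choose_zero_right, Nat.cast_one, mul_one]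
  have e2 : shear l i (lam * β) (X l - C lam * X j) = X l + C (lam * β) * X i - C lam * X j := by
    rw [map_sub, map_mul, algHom_C, algebraMap_eq, shear_X l i _ l, if_pos rfl, shear_X l i _ j, if_neg hjl]
  have e3 : shear j i β (X l + C (lam * β) * X i - C lam * X j) = X l - C lam * X j := by
    rw [map_sub, map_add, map_mul (shear j i β), map_mul (shear j i β), algHom_C, algHom_C, algebraMap_eq, shear_X j i β l,
      if_neg (Ne.symm hjl), shear_X j i β i, if_neg hij, shear_X j i β j, if_pos rfl, map_mul]
    ring
  have e6 : shear j l μ' (X l - C lam * X j) = C (1 - lam * μ') * X l + C (-lam) * X j := by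
    rw [map_sub, map_mul (shear j l μ'), algHom_C, algebraMap_eq, shear_X j l μ' l, if_neg (Ne.symm hjl), shear_X j l μ' j,
      if_pos rfl, map_sub, map_one, map_mul, map_neg]
    ring
  rw [hP, map_mul, map_pow, e1, e2, map_mul, map_pow, e3, map_mul, map_pow, e6]
  -- `σ_{j,l,μ'} σ_{j,i,β} (φ₀ u^r)` as a double sum of monomials
  have hri' : ∀ n, shearExp i l j r n i = r i + n := fun n => shearExp_apply_fst hil hij r n
  have hrl' : ∀ n, shearExp i l j r n l = 0 := fun n => by rw [shearExp_apply_snd hil hjl.symm, hrl]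
  have hrj' : ∀ n, shearExp i l j r n j = r j - n := fun n => shearExp_apply_thd hij hjl.symm r n
  rw [shear_monomial hil hij hjl.symm β r φ₀, map_sum, Finset.sum_mul, coeff_sum, Finset.sum_eq_single (r j)]
  · -- the term `n = r j`: `φ₀ β^{r j} u_i^{r i + r j}`, fixed by `σ_{j,l,μ'}`
    rw [shear_monomial (Ne.symm hil) (Ne.symm hjl) hij μ' _ _, hrj', Nat.sub_self, zero_add, Finset.sum_range_one,
      shearExp_zero (Ne.symm hil) (Ne.symm hjl) hij, pow_zero, mul_one, Nat.choose_zero_right, Nat.cast_one, mul_one,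
      coeff_monomial_mul', if_pos, Nat.choose_self, Nat.cast_one, mul_one]
    · have hBD : B - shearExp i l j r (r j) = Finsupp.single l s := by
        ext w
        rw [Finsupp.tsub_apply]
        rcases fin3_eq_or i j l w hij hil hjl with h | h | h <;> rw [h]
        · rw [hBi, hri', Finsupp.single_apply, if_neg (Ne.symm hil)]; omega
        · rw [hBj, hrj', Finsupp.single_apply, if_neg (Ne.symm hjl)]; omega
        · rw [hBl, hrl', Finsupp.single_eq_same]; omega
      rw [hBD, coeff_single_linear_pow₂ (Ne.symm hjl) (-lam) (1 - lam * μ') s]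
    · intro w
      rcases fin3_eq_or i j l w hij hil hjl with h | h | h <;> rw [h]
      · rw [hri', hBi]
      · rw [hrj', hBj]; omega
      · rw [hrl', hBl]; omega
  · intro n hn hne
    have hn' : n ≤ r j := Nat.lt_succ_iff.mp (Finset.mem_range.mp hn)
    rw [shear_monomial (Ne.symm hil) (Ne.symm hjl) hij μ' _ _, Finset.sum_mul, coeff_sum]
    refine Finset.sum_eq_zero fun n' _ => ?_
    rw [coeff_monomial_mul']
    split_ifs with hle
    · rw [coeff_linear_pow₂_eq_zero (w := i) hij hil (-lam) (1 - lam * μ'), mul_zero]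
      rw [Finsupp.tsub_apply, hBi, shearExp_apply_snd (Ne.symm hil) hij, hri']
      omega
    · rfl
  · intro h; exact absurd (Finset.mem_range.mpr (Nat.lt_succ_self _)) h

end PencilA2

end Summit.ResolutionOfSingularities.ResolutionOfSingularities.Theorems.LossPolygon
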